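import Summits.QuantumFields.YangMills.Theorems.BalabanUVNodesN19SizeWindow
import Summits.QuantumFields.YangMills.Theorems.BalabanUVNodesN19CoreKnit

/-!
# BalabanUVNodes ∕ N19 size window, II — the term-wise route END TO END FROM THE SIBLING NODES' TYPED OUTPUTS with the
# (2.43)-faithful size binder (Track A node N19 = spine estimate NE7, cluster K5 «SpineMatching»; seat dag-n19-b;
# count-neutral; companion of `BalabanUVNodesN19SizeWindow`)

HONEST FRAMING.  Estimate NE7 (`Spine.NE7.Core` = `T4GoodClassBudget.GoodClause`, with `Summable δ`) is NOT PRINTED in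
[Balaban1987RG1]–[Balaban1989LargeFieldII] and NOT proved here.  `BalabanUVNodesN19SizeWindow` repaired the NE7 desk's WATCH
W-NE7-1 — the term-wise route's size binder `S ≤ vol·E·a^{K−j}` is the top level `n = k` of [Balaban1988Convergent] Thm 2
(2.43) only, whereas the printed right side `E₁ Σ_{n=j}^{k}(L^{j−n})^β|Γ_n∩Ω|` on the recent log window costs a polynomial
weight `E K = E₀·(K+1)^m` — at the Literature ENDs `T4TowerRateComposition.goodClause_summable_of_termBudget` and
`T4TermwiseBudget.termBudget_of_ledger`.  This file threads the same size PROFILE `E : ℕ → ℝ` through the remaining layer of the route of record in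
the letter of node U2's OUTPUT (`InjectedRate … disc`), BY NAME and verbatim otherwise, on top of the twin seat's knit
`BalabanUVNodesN19CoreKnit` (dag-n19-a, p409134: `termBudget_of_towerRate_sizeProfile` with the profile, and the N19 knit
`core_summable_of_spineNodes` in the letter of node U2's INPUTS `ScaleShiftRate` …): §1 `termBudget_of_nodes_sizeProfile`
(= `T4TermwiseBudget.termBudget_of_nodes`: the sibling nodes' typed outputs NE9 + fading memory, Lipschitz-in-the-background
with polynomial growth, NE5, NE3 = `LocalRate` + the liaison `GaugeDominated`, node U2's injected coupling rate — the THREE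
BRACKETS of `T4OutputRate.u3_threeBrackets` composed along the tower by `T4TowerRateDischarge.uRateUpTo_of_nodes` — fed into
`N19CoreKnit.termBudget_of_towerRate_sizeProfile`), §2 `core_summable_of_nodes_polySize` (= `T4TermwiseBudget.goodClause_summable_of_nodes`
with `E K = E₀(K+1)^m`, concluded as N19's decl of record `Spine.NE7.Core … δ ∧ Summable δ` by `N19CoreKnit.core_summable_of_termBudget`);
§3 (section `Profile`) discharges the window hypotheses of the size profile from the route's OWN binders
`T4GoodClassBudget.RecentOnly` ∕ `WindowMultiplicity` BY NAME (`levelVolume_profile`, `sum_logWindow_le_of_recentOnly`) — the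
input the knits' binder `hSle` asks for; §4 (section `Deviation`) does the same for the hazard-H-U5b-1 binder `hdev`:
`|C_τ − c₀| ≤ vol·s K` with `s K = Cs(1+Cδ)Cw·windowSum θ Λ (jlog K) K` from `T4GoodClassBudget.RecentDeviation` + node U2's
`InjectedRate`, and `Summable s` (`summable_devProfile_log`).  So both WINDOW-shaped binders of the N19 knits are reduced to
the tree's primitive per-term shapes; what is left in them is per-term data of Bałaban's ledger (NODE O).
EVERY hypothesis is a binder (none printed as a two-run statement; nothing of Bałaban's expansions is asserted); which terms
are window-good, and the term format ∕ one-run sizes ∕ multiplicity ∕ other kinds ∕ hazard H-U5b-1, are decidable only on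
the two-run ledger of Bałaban's (2.18) representation (cell NODE O ∕ NODE 00 Stage 5 — not in the tree).  One fixed finite
torus, rung (B)+1; NOT infinite volume, NOT a mass gap, NOT Clay.  0 `def`, 0 `sorry`, standard axioms.

CITATION HEADER.  [Balaban1988Convergent] T. Bałaban, *Convergent renormalization expansions for lattice gauge theories*,
Commun. Math. Phys. **119** (1988) 243–285: Theorem 2 (2.43) p. 263 (the one-run size with the large-field volumes — the
located reason for the profile), (2.25) p. 259 (vacuum-energy subtraction, the shape of the E-factors) — quoted in the tree's
`B14.Thm2Printed` ∕ `T4TermwiseBudget` docstrings; used ONLY as the shape of hypotheses.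
-/

open Finset MeasureTheory

namespace Summit.QuantumFields.YangMills.BalabanUVNodes.N19SizeWindow

open Literature.MathematicalPhysics.QuantumFieldTheory.Balaban1983to89
open T4OutputRate T4RecentScale T4GoodClassBudget T4CauchySum T4TowerRateComposition T4TowerRateDischarge
  T4TermwiseBudget
open Summit.QuantumFields.BalabanUV.T4Continuum.Spine

/-! ## §1 End to end from the sibling nodes' typed outputs (the three brackets composed along the tower), U2-OUTPUT letter -/

section Spine

open T4EtaRateMin (Readings LocalRate)
open T4RateLiaison (GaugeDominated)

variable {C : Carriers} {ι X : Type} [MeasurableSpace ι] {σ : Type*} [DecidableEq σ] {l₀ vol : ℝ}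
  {T : ℕ → Finset σ} {Bad : ℕ → ℝ → Finset σ} {A B : ℕ → ℝ → σ → ℝ} {μ : ℕ → ℝ → σ → Measure ι}
  {fac : ℕ → ℝ → σ → Finset C.Dom} {R : Readings ι X} {W : Set (ℕ → ℝ)} {EA : Functional C C.BgA}
  {EB : Functional C C.BgB} {κ θ₅ C₅ C₉ ω θc Cd γ C₃ θ₃ P θ' : ℝ} {q : ℕ} {Λm : ℕ → ℕ → ℝ}
  {CU : (ℕ → ℝ) → ℕ → ℝ} {g : ℕ → ℕ → ℝ} {uA : ℕ → ι → C.BgA} {uB : ℕ → ι → C.BgB} {oneA : C.BgA} {oneB : C.BgB}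
  {oA oB : ℕ → ℝ → σ → ι → ℝ} {κ₁ S : ℕ → ℝ → σ → ℕ → ℝ} {cO RO : ℕ → ℝ → σ → ℝ} {rO E : ℕ → ℝ} {Cw a Λ : ℝ}

/-- **THE TERM-WISE ROUTE END TO END, SIZE PROFILE CUTOFF-DEPENDENT** — `T4TermwiseBudget.termBudget_of_nodes` verbatim
(inputs BY NAME: NE9 + fading memory `Λm`, Lipschitz-in-the-background with polynomial growth, NE5, NE3 = `LocalRate` + the
liaison `GaugeDominated`, node U2's `InjectedRate … disc` on the printed box, both runs' couplings in the window — the three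
brackets of `T4OutputRate.u3_threeBrackets` composed along the tower by `T4TowerRateDischarge.uRateUpTo_of_nodes` —; term
format along NE3's reading family; one-run size centrings; multiplicity; other kinds) except `hSle : S ≤ vol·(E K·a^{K−j})`
with a nonnegative profile `E : ℕ → ℝ` (fed to the twin seat's `N19CoreKnit.termBudget_of_towerRate_sizeProfile`).  OUTPUT:
the tower's rate constant `Cr ≥ 0` (K-uniform) and, granted H-U5b-1 on the centres chosen with it, the per-term budget with
remainder rate `max(Cw,1)·(E K + Cr)·Σ_{j+n=K} min(aⁿ, θ′^jΛⁿ) + rO K`.  Not delivered: NE7's weight half, the R-kind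
two-run rate inside `rO`, the deviations `s`, the binders themselves. [folklore] -/
theorem termBudget_of_nodes_sizeProfile
    (h9 : NE9 EA W κ Λm) (hΛm : FadingMemory C₉ ω Λm) (hω : 0 ≤ ω)
    (hUL : LipBackground EA W κ CU) (hG : PolyLipGrowth CU g P q) (hP : 0 ≤ P)
    (h5 : NE5 EA EB W κ θ₅ C₅) (hθ₅ : 0 ≤ θ₅) (hC₅ : 0 ≤ C₅)
    (hloc : LocalRate R C₃ θ₃) (hC₃ : 0 ≤ C₃) (hθ₃ : 0 ≤ θ₃) (hθ₃1 : θ₃ < 1) (hgd : GaugeDominated R uA uB)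
    (hinj : InjectedRate Cd 0 θc (fun K j => T4CouplingMatching.disc (g K) (g (K + 1)) j)) (hCd : 0 ≤ Cd)
    (hθc : 0 ≤ θc) (hbox : ∀ K i, i ≤ K → 0 < g K i ∧ g K i ≤ γ)
    (hgA : ∀ K, g K ∈ W) (hgB : ∀ K, (fun i => g (K + 1) (i + 1)) ∈ W)
    (hθ' : max ω θc < θ') (hθ₅' : θ₅ ≤ θ') (hθ₃' : θ₃ ≤ θ')
    (hfmtA : ∀ K t τ, A K t τ = ∫ v, (∏ X ∈ fac K t τ,
      Real.exp (EA (g K) (uA K v) X - EA (g K) oneA X)) * oA K t τ v ∂(μ K t τ))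
    (hfmtB : ∀ K t τ, B K t τ = ∫ v, (∏ X ∈ fac K t τ,
      Real.exp (EB (fun i => g (K + 1) (i + 1)) (uB K v) X - EB (fun i => g (K + 1) (i + 1)) oneB X)) *
        oB K t τ v ∂(μ K t τ))
    (hint : ∀ K t, |t| ≤ l₀ → ∀ τ ∈ T K \ Bad K t,
      Integrable (fun v => (∏ X ∈ fac K t τ, Real.exp (EA (g K) (uA K v) X - EA (g K) oneA X)) *
        oA K t τ v) (μ K t τ) ∧
      Integrable (fun v => (∏ X ∈ fac K t τ,
        Real.exp (EB (fun i => g (K + 1) (i + 1)) (uB K v) X - EB (fun i => g (K + 1) (i + 1)) oneB X)) *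
        oB K t τ v) (μ K t τ))
    (hsc : ∀ K t, |t| ≤ l₀ → ∀ τ ∈ T K \ Bad K t, ∀ X ∈ fac K t τ, C.scale X ≤ K)
    (hposO : ∀ K t, |t| ≤ l₀ → ∀ τ ∈ T K \ Bad K t, ∀ v ∈ R.dom, 0 < oA K t τ v ∧ 0 < oB K t τ v)
    (hoff : ∀ K t, |t| ≤ l₀ → ∀ τ ∈ T K \ Bad K t, ∀ v, v ∉ R.dom →
      (∏ X ∈ fac K t τ, Real.exp (EA (g K) (uA K v) X - EA (g K) oneA X)) * oA K t τ v = 0 ∧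
      (∏ X ∈ fac K t τ,
        Real.exp (EB (fun i => g (K + 1) (i + 1)) (uB K v) X - EB (fun i => g (K + 1) (i + 1)) oneB X)) *
        oB K t τ v = 0)
    (hS : ∀ K t, |t| ≤ l₀ → ∀ τ ∈ T K \ Bad K t, ∀ v ∈ R.dom, ∀ j ≤ K,
      |(∑ X ∈ fac K t τ with C.scale X = j,
          (Real.log (Real.exp (EB (fun i => g (K + 1) (i + 1)) (uB K v) X
              - EB (fun i => g (K + 1) (i + 1)) oneB X))
            - Real.log (Real.exp (EA (g K) (uA K v) X - EA (g K) oneA X)))) - κ₁ K t τ j| ≤ S K t τ j)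
    (hM : ∀ K t, |t| ≤ l₀ → ∀ τ ∈ T K \ Bad K t,
      Multiplicity (fac K t τ) C.scale (fun X => Real.exp (-(κ * C.d X))) Cw vol Λ K)
    (hO : ∀ K t, |t| ≤ l₀ → ∀ τ ∈ T K \ Bad K t, ∀ v ∈ R.dom,
      |Real.log (oB K t τ v) - Real.log (oA K t τ v) - cO K t τ| ≤ RO K t τ)
    (hvol : 0 ≤ vol) (hE : ∀ K, 0 ≤ E K) (ha : 0 ≤ a) (hΛ : 0 ≤ Λ)
    (hSle : ∀ K t, |t| ≤ l₀ → ∀ τ ∈ T K \ Bad K t, ∀ j ≤ K, S K t τ j ≤ vol * (E K * a ^ (K - j)))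
    (hRO : ∀ K t, |t| ≤ l₀ → ∀ τ ∈ T K \ Bad K t, RO K t τ ≤ vol * rO K) :
    ∃ Cr : ℝ, 0 ≤ Cr ∧ ∀ c₀ s : ℕ → ℝ,
      (∀ K t, |t| ≤ l₀ → ∀ τ ∈ T K \ Bad K t,
        |((∑ j ∈ range (K + 1), sliceCentre (κ₁ K t τ)
            (fun j => ∑ X ∈ fac K t τ with C.scale X = j,
              (-(EB (fun i => g (K + 1) (i + 1)) oneB X - EA (g K) oneA X)))
            (S K t τ) (fun j => Cw * vol * (Cr * θ' ^ j * Λ ^ (K - j))) j) + cO K t τ) - c₀ K| ≤ vol * s K) →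
      TermBudget l₀ vol T A B Bad
        (fun K t τ => (∑ j ∈ range (K + 1), sliceCentre (κ₁ K t τ)
            (fun j => ∑ X ∈ fac K t τ with C.scale X = j,
              (-(EB (fun i => g (K + 1) (i + 1)) oneB X - EA (g K) oneA X)))
            (S K t τ) (fun j => Cw * vol * (Cr * θ' ^ j * Λ ^ (K - j))) j) + cO K t τ)
        (fun K t τ => (∑ j ∈ range (K + 1), min (S K t τ j) (Cw * vol * (Cr * θ' ^ j * Λ ^ (K - j))))
            + RO K t τ)
        c₀ (fun K => max Cw 1 * ((E K + Cr) * ∑ x ∈ antidiagonal K, min (a ^ x.2) (θ' ^ x.1 * Λ ^ x.2)) + rO K)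
        s := by
  obtain ⟨a₀, ha₀, hUK⟩ := uRateUpTo_of_nodes h9 hΛm hω hUL hG hP h5 hθ₅ hC₅ hloc hC₃ hθ₃ hθ₃1 hgd hinj hCd hθc
    hbox hgA hgB hθ' hθ₅' hθ₃'
  have hθ'0 : 0 ≤ θ' := hθc.trans ((le_max_right ω θc).trans hθ'.le)
  have hC₉ : 0 ≤ C₉ := fadingMemory_const_nonneg hΛm
  have hD : 0 ≤ γ ^ 3 * Cd := mul_nonneg (pow_nonneg (box_nonneg hbox) 3) hCd
  have hCr : 0 ≤ a₀ + C₉ * (γ ^ 3 * Cd) * (θ' / (θ' - max ω θc)) + C₅ :=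
    add_nonneg (add_nonneg ha₀ (mul_nonneg (mul_nonneg hC₉ hD) (div_nonneg hθ'0 (sub_pos.mpr hθ').le))) hC₅
  refine ⟨a₀ + C₉ * (γ ^ 3 * Cd) * (θ' / (θ' - max ω θc)) + C₅, hCr, fun c₀ s hdev => ?_⟩
  exact N19CoreKnit.termBudget_of_towerRate_sizeProfile hUK hCr hθ'0 hΛ hfmtA hfmtB hint hsc hposO hoff hS hM hO
    hvol hE ha hSle hRO hdev

/-- **… WHENCE NODE N19's DECL OF RECORD WITH `Summable δ`, POLYNOMIAL SIZE PROFILE, U2-OUTPUT LETTER** —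
`T4TermwiseBudget.goodClause_summable_of_nodes` with `E K = E₀·(K+1)^m` (the log window's size constant,
`BalabanUVNodesN19SizeWindow` §1) in place of the cutoff-free `E`, concluded as `Spine.NE7.Core l₀ vol T Bad A B δ ∧ Summable δ`
(`= GoodClause`, `Iff.rfl`; via `N19CoreKnit.core_summable_of_termBudget`) with
`δ K = max(Cw,1)·(E₀(K+1)^m + Cr)·Σ_{j+n=K} min(aⁿ, θ′^jΛⁿ) + rO K + s K` (`summable_eBranch_polySize` at `p = 0`), for `0 < a < 1`,
`θ′ < 1`, `θ′ ≤ Λ`, summable `rO`, `s`.  The twin's `N19CoreKnit.core_summable_of_spineNodes` is the same knit in the letter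
of node U2's INPUTS (N17's `ScaleShiftRate` …); this one takes node U2's OUTPUT `InjectedRate … disc`.  CONDITIONAL on every
binder named; NE7 is NOT PRINTED and NOT proved. [folklore] -/
theorem core_summable_of_nodes_polySize {E₀ : ℝ} {m : ℕ}
    (h9 : NE9 EA W κ Λm) (hΛm : FadingMemory C₉ ω Λm) (hω : 0 ≤ ω)
    (hUL : LipBackground EA W κ CU) (hG : PolyLipGrowth CU g P q) (hP : 0 ≤ P)
    (h5 : NE5 EA EB W κ θ₅ C₅) (hθ₅ : 0 ≤ θ₅) (hC₅ : 0 ≤ C₅)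
    (hloc : LocalRate R C₃ θ₃) (hC₃ : 0 ≤ C₃) (hθ₃ : 0 ≤ θ₃) (hθ₃1 : θ₃ < 1) (hgd : GaugeDominated R uA uB)
    (hinj : InjectedRate Cd 0 θc (fun K j => T4CouplingMatching.disc (g K) (g (K + 1)) j)) (hCd : 0 ≤ Cd)
    (hθc : 0 ≤ θc) (hbox : ∀ K i, i ≤ K → 0 < g K i ∧ g K i ≤ γ)
    (hgA : ∀ K, g K ∈ W) (hgB : ∀ K, (fun i => g (K + 1) (i + 1)) ∈ W)
    (hθ' : max ω θc < θ') (hθ₅' : θ₅ ≤ θ') (hθ₃' : θ₃ ≤ θ')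
    (hfmtA : ∀ K t τ, A K t τ = ∫ v, (∏ X ∈ fac K t τ,
      Real.exp (EA (g K) (uA K v) X - EA (g K) oneA X)) * oA K t τ v ∂(μ K t τ))
    (hfmtB : ∀ K t τ, B K t τ = ∫ v, (∏ X ∈ fac K t τ,
      Real.exp (EB (fun i => g (K + 1) (i + 1)) (uB K v) X - EB (fun i => g (K + 1) (i + 1)) oneB X)) *
        oB K t τ v ∂(μ K t τ))
    (hint : ∀ K t, |t| ≤ l₀ → ∀ τ ∈ T K \ Bad K t,
      Integrable (fun v => (∏ X ∈ fac K t τ, Real.exp (EA (g K) (uA K v) X - EA (g K) oneA X)) *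
        oA K t τ v) (μ K t τ) ∧
      Integrable (fun v => (∏ X ∈ fac K t τ,
        Real.exp (EB (fun i => g (K + 1) (i + 1)) (uB K v) X - EB (fun i => g (K + 1) (i + 1)) oneB X)) *
        oB K t τ v) (μ K t τ))
    (hsc : ∀ K t, |t| ≤ l₀ → ∀ τ ∈ T K \ Bad K t, ∀ X ∈ fac K t τ, C.scale X ≤ K)
    (hposO : ∀ K t, |t| ≤ l₀ → ∀ τ ∈ T K \ Bad K t, ∀ v ∈ R.dom, 0 < oA K t τ v ∧ 0 < oB K t τ v)
    (hoff : ∀ K t, |t| ≤ l₀ → ∀ τ ∈ T K \ Bad K t, ∀ v, v ∉ R.dom →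
      (∏ X ∈ fac K t τ, Real.exp (EA (g K) (uA K v) X - EA (g K) oneA X)) * oA K t τ v = 0 ∧
      (∏ X ∈ fac K t τ,
        Real.exp (EB (fun i => g (K + 1) (i + 1)) (uB K v) X - EB (fun i => g (K + 1) (i + 1)) oneB X)) *
        oB K t τ v = 0)
    (hS : ∀ K t, |t| ≤ l₀ → ∀ τ ∈ T K \ Bad K t, ∀ v ∈ R.dom, ∀ j ≤ K,
      |(∑ X ∈ fac K t τ with C.scale X = j,
          (Real.log (Real.exp (EB (fun i => g (K + 1) (i + 1)) (uB K v) X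
              - EB (fun i => g (K + 1) (i + 1)) oneB X))
            - Real.log (Real.exp (EA (g K) (uA K v) X - EA (g K) oneA X)))) - κ₁ K t τ j| ≤ S K t τ j)
    (hM : ∀ K t, |t| ≤ l₀ → ∀ τ ∈ T K \ Bad K t,
      Multiplicity (fac K t τ) C.scale (fun X => Real.exp (-(κ * C.d X))) Cw vol Λ K)
    (hO : ∀ K t, |t| ≤ l₀ → ∀ τ ∈ T K \ Bad K t, ∀ v ∈ R.dom,
      |Real.log (oB K t τ v) - Real.log (oA K t τ v) - cO K t τ| ≤ RO K t τ)
    (hvol : 0 ≤ vol) (hE₀ : 0 ≤ E₀) (ha0 : 0 < a) (ha1 : a < 1) (hθ'1 : θ' < 1) (hθ'Λ : θ' ≤ Λ)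
    (hSle : ∀ K t, |t| ≤ l₀ → ∀ τ ∈ T K \ Bad K t, ∀ j ≤ K,
      S K t τ j ≤ vol * (E₀ * ((K : ℝ) + 1) ^ m * a ^ (K - j)))
    (hRO : ∀ K t, |t| ≤ l₀ → ∀ τ ∈ T K \ Bad K t, RO K t τ ≤ vol * rO K) (hrO : Summable rO) :
    ∃ Cr : ℝ, 0 ≤ Cr ∧ ∀ c₀ s : ℕ → ℝ, Summable s →
      (∀ K t, |t| ≤ l₀ → ∀ τ ∈ T K \ Bad K t,
        |((∑ j ∈ range (K + 1), sliceCentre (κ₁ K t τ)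
            (fun j => ∑ X ∈ fac K t τ with C.scale X = j,
              (-(EB (fun i => g (K + 1) (i + 1)) oneB X - EA (g K) oneA X)))
            (S K t τ) (fun j => Cw * vol * (Cr * θ' ^ j * Λ ^ (K - j))) j) + cO K t τ) - c₀ K| ≤ vol * s K) →
      NE7.Core l₀ vol T Bad A B
          (fun K => (max Cw 1 * ((E₀ * ((K : ℝ) + 1) ^ m + Cr) *
              ∑ x ∈ antidiagonal K, min (a ^ x.2) (θ' ^ x.1 * Λ ^ x.2)) + rO K) + s K) ∧
        Summable (fun K : ℕ => (max Cw 1 * ((E₀ * ((K : ℝ) + 1) ^ m + Cr) *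
              ∑ x ∈ antidiagonal K, min (a ^ x.2) (θ' ^ x.1 * Λ ^ x.2)) + rO K) + s K) := by
  have hθ'0 : 0 < θ' := lt_of_le_of_lt (hθc.trans (le_max_right ω θc)) hθ'
  have hΛ : 0 ≤ Λ := hθ'0.le.trans hθ'Λ
  have hE : ∀ K : ℕ, 0 ≤ E₀ * ((K : ℝ) + 1) ^ m := fun K => mul_nonneg hE₀ (by positivity)
  obtain ⟨Cr, hCr, hTB⟩ := termBudget_of_nodes_sizeProfile (E := fun K : ℕ => E₀ * ((K : ℝ) + 1) ^ m)
    h9 hΛm hω hUL hG hP h5 hθ₅ hC₅ hloc hC₃ hθ₃ hθ₃1 hgd hinj hCd hθc hbox hgA hgB hθ' hθ₅' hθ₃' hfmtA hfmtB hint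
    hsc hposO hoff hS hM hO hvol hE ha0.le hΛ hSle hRO
  refine ⟨Cr, hCr, fun c₀ s hs hdev => ?_⟩
  have hsum : Summable (fun K : ℕ =>
      (E₀ * ((K : ℝ) + 1) ^ m + Cr) * ∑ x ∈ antidiagonal K, min (a ^ x.2) (θ' ^ x.1 * Λ ^ x.2)) := by
    refine (summable_eBranch_polySize (m := m) (p := 0) hE₀ hCr ha0 ha1 hθ'0 hθ'1 hθ'Λ).congr fun K => ?_
    rw [pow_zero, mul_one]
  exact N19CoreKnit.core_summable_of_termBudget (E := fun K : ℕ => E₀ * ((K : ℝ) + 1) ^ m) (hTB c₀ s hdev) hsum hrO hs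

end Spine

/-! ## §3 The window profile read off the route's own binders `RecentOnly` ∕ `WindowMultiplicity` BY NAME -/

section Profile

variable {κ : Type*} {dof : Finset κ} {sc : κ → ℕ} {w : κ → ℝ} {Cw vol Λ : ℝ} {jstar K : ℕ}

/-- A good term's PENDING structures (the route's `T4GoodClassBudget.RecentOnly dof sc jstar K`: every creation scale in
the window `[jstar, K]`) with window multiplicity (`WindowMultiplicity dof sc w Cw vol Λ jstar K`) have the level-volume
profile of `BalabanUVNodesN19SizeWindow.sum_window_le`: the level-`n` volume `Σ_{sc i = n} w_i` VANISHES for `n < jstar` and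
is `≤ Cw·vol·Λ^{K−n}` on the window. [folklore] -/
theorem levelVolume_profile (hrec : RecentOnly dof sc jstar K) (hM : WindowMultiplicity dof sc w Cw vol Λ jstar K) :
    (∀ n, n < K → n < jstar → ∑ i ∈ dof with sc i = n, w i = 0) ∧
      (∀ n, n < K → jstar ≤ n → ∑ i ∈ dof with sc i = n, w i ≤ Cw * vol * Λ ^ (K - n)) := by
  refine ⟨fun n _ hnj => ?_, fun n hnK hjn => hM n hjn hnK.le⟩
  have hempty : (dof.filter fun i => sc i = n) = ∅ := by
    refine Finset.filter_eq_empty_iff.mpr fun i hi hsc => ?_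
    have := (hrec i hi).1
    omega
  rw [hempty, Finset.sum_empty]

/-- **THE (2.43) RIGHT SIDE OF A WINDOW-GOOD TERM, FROM THE ROUTE'S BINDERS.**  With the log cut `jstar = jlog(K)`
(`jlogOf Cl K`), `0 < a ≤ 1 ≤ Λ`, `0 ≤ vol`, `j ≤ K` (any `Cw`; `max(Cw,1)` absorbs it), a current-region volume `ΓK ≤ vol` at the top level and the
pending structures' level volumes below it: `Σ_{n=j}^{K} a^{n−j}·Γ_n ≤ (max(Cw,1)·vol)·(1 + (Cl+1)(Λ∕a))·(K+1)^{⌈Cl·log(Λ∕a)⌉+1}·a^{K−j}`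
— the size binder `hSle` of §1–§2 with `E K` polynomial in `K`, its window hypotheses discharged from `RecentOnly` and
`WindowMultiplicity` (which the route already carries for hazard H-U5b-1). [folklore] -/
theorem sum_logWindow_le_of_recentOnly {a Cl ΓK : ℝ} {j : ℕ} (ha0 : 0 < a) (ha1 : a ≤ 1) (hΛ : 1 ≤ Λ)
    (hCl : 0 ≤ Cl) (hvol : 0 ≤ vol) (hjK : j ≤ K) (hΓK : ΓK ≤ vol)
    (hrec : RecentOnly dof sc (jlogOf Cl K) K) (hM : WindowMultiplicity dof sc w Cw vol Λ (jlogOf Cl K) K) :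
    ∑ n ∈ Icc j K, a ^ (n - j) * (if n = K then ΓK else ∑ i ∈ dof with sc i = n, w i)
      ≤ (max Cw 1 * vol) * ((1 + (Cl + 1) * (Λ / a)) * ((K : ℝ) + 1) ^ (⌈Cl * Real.log (Λ / a)⌉₊ + 1))
          * a ^ (K - j) := by
  obtain ⟨hold, hwin⟩ := levelVolume_profile hrec hM
  have hv1 : vol ≤ max Cw 1 * vol := by
    calc vol = 1 * vol := (one_mul _).symm
      _ ≤ max Cw 1 * vol := mul_le_mul_of_nonneg_right (le_max_right _ _) hvol
  have hvC : Cw * vol ≤ max Cw 1 * vol := mul_le_mul_of_nonneg_right (le_max_left _ _) hvol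
  refine sum_logWindow_le (Γ := fun n => if n = K then ΓK else ∑ i ∈ dof with sc i = n, w i) ha0 ha1 hΛ hCl
    (mul_nonneg (zero_le_one.trans (le_max_right _ _)) hvol) hjK ?_ ?_ ?_
  · simp only [if_true]; exact hΓK.trans hv1
  · intro n hnK hnj
    simp only [hnK.ne, if_false]
    exact hold n hnK hnj
  · intro n hnK hjn
    simp only [hnK.ne, if_false]
    calc ∑ i ∈ dof with sc i = n, w i ≤ Cw * vol * Λ ^ (K - n) := hwin n hnK hjn
      _ ≤ max Cw 1 * vol * Λ ^ (K - n) :=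
          mul_le_mul_of_nonneg_right hvC (pow_nonneg (zero_le_one.trans hΛ) _)

end Profile

/-! ## §4 The deviation binder `hdev` with a SUMMABLE profile, from `RecentDeviation` on the log window BY NAME -/

section Deviation

variable {κ : Type*} {dof : Finset κ} {sc : κ → ℕ} {w e : κ → ℝ} {Cs θ Cδ Cw vol Λ Cτ c₀ Cl : ℝ}
  {δ : ℕ → ℕ → ℝ} {K : ℕ}

/-- **HAZARD H-U5b-1's BINDER IN THE KNITS' LETTER.**  A good term whose constant is `C_τ = c₀ + Σ_{dof} e_i` over its
RECENT degrees of freedom with `T4GoodClassBudget.RecentDeviation dof sc w e Cs θ (δ K) Cw vol Λ (jlog K) K` (the tree's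
shape of H-U5b-1, NOT PRINTED) and node U2's merged discrepancy `InjectedRate Cδ 0 θ δ` satisfies the deviation binder
`hdev` of `termBudget_of_ledger(_sizeProfile)` ∕ `N19CoreKnit.core_summable_of_spineNodes` ∕ §1–§2 above in the form
`|C_τ − c₀| ≤ vol·s K` with the EXPLICIT profile `s K = Cs(1+Cδ)Cw·windowSum θ Λ (jlog K) K`
(`T4GoodClassBudget.abs_sub_centre_le_windowSum`, rearranged). [folklore] -/
theorem dev_le_of_recentDeviation (hC : Cτ = c₀ + ∑ i ∈ dof, e i)
    (h : RecentDeviation dof sc w e Cs θ (δ K) Cw vol Λ (jlogOf Cl K) K) (hδ : InjectedRate Cδ 0 θ δ)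
    (hCs : 0 ≤ Cs) (hCδ : 0 ≤ Cδ) (hθ : 0 ≤ θ) :
    |Cτ - c₀| ≤ vol * ((Cs * (1 + Cδ) * Cw) * windowSum θ Λ (jlogOf Cl K) K) := by
  calc |Cτ - c₀| ≤ Cs * (1 + Cδ) * (Cw * vol) * windowSum θ Λ (jlogOf Cl K) K :=
        abs_sub_centre_le_windowSum hC h hδ hCs hCδ hθ
    _ = vol * ((Cs * (1 + Cδ) * Cw) * windowSum θ Λ (jlogOf Cl K) K) := by ring

/-- … and that profile is SUMMABLE over the cutoff for every `0 < θ < 1`, `Λ ≥ 1`, `Cl ≥ 0` — the `Summable s` input of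
the knits (`T4GoodClassBudget.summable_windowSum_log`: on the log window the θ-sum is `poly(K)·θ^K`). [folklore] -/
theorem summable_devProfile_log (hθ : 0 < θ) (hθ1 : θ < 1) (hΛ : 1 ≤ Λ) (hCl : 0 ≤ Cl) :
    Summable (fun K => (Cs * (1 + Cδ) * Cw) * windowSum θ Λ (jlogOf Cl K) K) :=
  (summable_windowSum_log hθ hθ1 hΛ hCl).mul_left _

end Deviation

end Summit.QuantumFields.YangMills.BalabanUVNodes.N19SizeWindow
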